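import Summits.ValiantsHypothesis.ValiantsHypothesis.Theorems.KPlusLogSqLawWeakLiftingTowerGraftTwoSidedExchangeSplit
import Summits.ValiantsHypothesis.ValiantsHypothesis.Theorems.KPlusLogSqLawWeakLiftingTowerGraftTwoSidedLoewner

/-!
# Tower graft line — the split-certificate law for FAMILIES (scales may repeat): clustered and commensurable supports

Crux `stmt-ValiantsHypothesis-19561` (`WeakLifting`), line (B) `tower_graft`, two-sided word instrument; seat val-sym-lift-p3 g21,
`--supports 19561`, NO stub claimed.  Family form (repeated scales, same-scale kernel vectors POLARISED for the type form
`e P₀ − Σₗ (dₗ − e)τ^{dₗ} Pₗ` — what an orthogonal kernel basis delivers) of `…TwoSidedExchangeSplit`: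
* `card_negType_le_rank_split_family` — `#I ≤ rank P₀ + Σₗ rₗ·rank Pₗ` for split certificates (`Nₗ + Σⱼ wwᵀ ⪰ 0`);
* `card_negType_family_le_rank_commensurable` — commensurable supports `dₗ = e(qₗ+1)`: `≤ rank P₀ + Σₗ qₗ·rank Pₗ` (the exchange certificate
  is one formula at all pairs, equal scales included);
* `card_negType_family_le_rank_clustered` — clustered supports `e < dₗ ≤ 2e`: `≤ rank P₀` (part F for families; Loewner certificates at
  repeated nodes from `Loewner.exists_loewner_certificate`).
These feed the definite-type (any corank) census laws of `…TwoSidedDefiniteAny`.  HONEST FRAMING: structural laws for one-pivot words;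
nothing on S4…S5, `TowerB`, `WeakLifting` in its window, Conjecture B, 18050 or `VP ≠ VNP`.  Def-free.

[folklore] Gram/Hadamard rank arguments.
-/

set_option linter.dupNamespace false
set_option autoImplicit false

namespace Summit.ValiantsHypothesis.ValiantsHypothesis.Theorems.KPlusLogSqLaw.TowerGraft

open Matrix
open scoped BigOperators

namespace TwoSidedThree

/-! ## §1 The split-certificate law for FAMILIES (scales may repeat; same-scale pairs polarised) -/

section SplitFamily

variable {m : ℕ} {I : Type} [Fintype I] [DecidableEq I] {L : ℕ}
variable (P₀ J : Matrix (Fin m) (Fin m) ℝ) (P : Fin L → Matrix (Fin m) (Fin m) ℝ) (e : ℕ) (d : Fin L → ℕ)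
  (τ : I → ℝ) (u : I → Fin m → ℝ)

/-- **SPLIT-CERTIFICATE LAW, FAMILY FORM.**  As `card_negType_le_rank_split`, but the scales `τᵢ` may REPEAT: the off-diagonal
certificate relation is asked only for `τᵢ ≠ τₖ`, the diagonal one for all equal-scale pairs (`e·(Nₗ)ᵢₖ = (dₗ − e)τₖ^{dₗ}` when `τᵢ = τₖ`),
and two different kernel vectors at the same scale are POLARISED: `e⟨uᵢ,P₀uₖ⟩ = Σₗ (dₗ − e)τ^{dₗ}⟨uᵢ,Pₗuₖ⟩` (orthogonality for the type form
`e P₀ − Σₗ (dₗ − e)τ^{dₗ} Pₗ`, supplied by an orthogonal kernel basis).  Conclusion: `#I ≤ rank P₀ + Σₗ rₗ·rank Pₗ`. [folklore] -/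
theorem card_negType_le_rank_split_family (hP₀ : P₀.PosSemidef) (hJ : J.IsSymm) (hP : ∀ l, (P l).PosSemidef)
    (hτ : ∀ i, 0 < τ i) (he : 0 < e)
    (hker : ∀ i, (P₀ + τ i ^ e • J + ∑ l, τ i ^ d l • P l) *ᵥ u i = 0)
    (htype : ∀ i, ∑ l, ((d l - e : ℕ) : ℝ) * τ i ^ d l * (u i ⬝ᵥ (P l *ᵥ u i)) < e * (u i ⬝ᵥ (P₀ *ᵥ u i)))
    (hsame : ∀ i k, i ≠ k → τ i = τ k →
      (e : ℝ) * (u i ⬝ᵥ (P₀ *ᵥ u k)) = ∑ l, ((d l - e : ℕ) : ℝ) * τ k ^ d l * (u i ⬝ᵥ (P l *ᵥ u k)))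
    (N : Fin L → Matrix I I ℝ)
    (hNsame : ∀ l i k, τ i = τ k → (e : ℝ) * N l i k = ((d l - e : ℕ) : ℝ) * τ k ^ d l)
    (hNoff : ∀ l i k, τ i ≠ τ k → N l i k * (τ i ^ e - τ k ^ e) = τ i ^ d l * τ k ^ e - τ i ^ e * τ k ^ d l)
    (r : Fin L → ℕ) (w : (l : Fin L) → Fin (r l) → I → ℝ) (A : Fin L → Matrix I I ℝ) (hA : ∀ l, (A l).PosSemidef)
    (hsplit : ∀ l, N l + ∑ j, Matrix.vecMulVec (w l j) (w l j) = A l) :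
    Fintype.card I ≤ P₀.rank + ∑ l, r l * (P l).rank := by
  classical
  have hP₀s : P₀.IsSymm := by
    have h1 := hP₀.1; unfold Matrix.IsHermitian at h1
    rwa [Matrix.conjTranspose_eq_transpose_of_trivial] at h1
  have hPs : ∀ l, (P l).IsSymm := by
    intro l; have h1 := (hP l).1; unfold Matrix.IsHermitian at h1
    rwa [Matrix.conjTranspose_eq_transpose_of_trivial] at h1
  have hene : (e : ℝ) ≠ 0 := Nat.cast_ne_zero.mpr (Nat.pos_iff_ne_zero.mp he)
  have hepos : (0 : ℝ) < e := Nat.cast_pos.mpr he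
  set G₀ : Matrix I I ℝ := Matrix.of fun i' k' => u i' ⬝ᵥ (P₀ *ᵥ u k') with hG₀
  set G : Fin L → Matrix I I ℝ := fun l => Matrix.of fun i' k' => u i' ⬝ᵥ (P l *ᵥ u k') with hG
  have hGpsd : ∀ l, (G l).PosSemidef := fun l => posSemidef_gram (hP l) u
  set Δ : I → ℝ := fun i => u i ⬝ᵥ (P₀ *ᵥ u i) - ∑ l, (u i ⬝ᵥ (P l *ᵥ u i)) * N l i i with hΔdef
  -- `e · Σₗ gₗ(ik) Nₗ(ik) = Σₗ (dₗ − e) τₖ^{dₗ} gₗ(ik)` at equal scales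
  have hsum_same : ∀ i k, τ i = τ k →
      (e : ℝ) * ∑ l, (u i ⬝ᵥ (P l *ᵥ u k)) * N l i k = ∑ l, ((d l - e : ℕ) : ℝ) * τ k ^ d l * (u i ⬝ᵥ (P l *ᵥ u k)) := by
    intro i k hik
    rw [Finset.mul_sum]
    refine Finset.sum_congr rfl fun l _ => ?_
    rw [show (e : ℝ) * ((u i ⬝ᵥ (P l *ᵥ u k)) * N l i k) = ((e : ℝ) * N l i k) * (u i ⬝ᵥ (P l *ᵥ u k)) by ring,
      hNsame l i k hik, mul_comm]
  have hΔpos : ∀ i, 0 < Δ i := by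
    intro i
    have ht := htype i
    have h2 : (e : ℝ) * Δ i = e * (u i ⬝ᵥ (P₀ *ᵥ u i)) - ∑ l, ((d l - e : ℕ) : ℝ) * τ i ^ d l * (u i ⬝ᵥ (P l *ᵥ u i)) := by
      simp only [hΔdef]; rw [mul_sub, hsum_same i i rfl]
    have h3 : 0 < (e : ℝ) * Δ i := by rw [h2]; linarith
    exact pos_of_mul_pos_right h3 hepos.le
  have hdecomp : G₀ = (∑ l, G l ⊙ N l) + Matrix.diagonal Δ := by
    ext i k
    rw [Matrix.add_apply, hG₀, Matrix.of_apply, Matrix.sum_apply]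
    simp only [Matrix.hadamard_apply, hG, Matrix.of_apply]
    by_cases hik : i = k
    · subst hik
      rw [Matrix.diagonal_apply_eq]
      simp only [hΔdef]; ring
    · rw [Matrix.diagonal_apply_ne _ hik, add_zero]
      by_cases hτik : τ i = τ k
      · -- same scale: polarisation
        apply mul_left_cancel₀ hene
        rw [hsame i k hik hτik, hsum_same i k hτik]
      · have hne : τ i ^ e - τ k ^ e ≠ 0 := by
          intro h0
          apply hτik
          exact (pow_left_inj₀ (hτ i).le (hτ k).le (Nat.pos_iff_ne_zero.mp he)).mp (sub_eq_zero.mp h0)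
        have hg := gramP0_eq_clustered P₀ J P e d τ u hP₀s hJ hPs hker i k
        apply mul_left_cancel₀ hne
        rw [hg, Finset.mul_sum]
        refine Finset.sum_congr rfl fun l _ => ?_
        rw [← hNoff l i k hτik]
        ring
  set M : Matrix I I ℝ := (∑ l, G l ⊙ A l) + Matrix.diagonal Δ with hM
  have hS : (∑ l, G l ⊙ A l).PosSemidef := posSemidef_sum _ fun l => (hGpsd l).hadamard (hA l)
  have hMpd : M.PosDef := by
    rw [Matrix.posDef_iff_dotProduct_mulVec]
    refine ⟨?_, fun x hx => ?_⟩
    · have h1 := hS.1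
      have h2 : (Matrix.diagonal Δ).IsHermitian := by
        rw [Matrix.IsHermitian, Matrix.conjTranspose_eq_transpose_of_trivial, Matrix.diagonal_transpose]
      exact h1.add h2
    · rw [hM, Matrix.add_mulVec, dotProduct_add]
      have h1 : 0 ≤ star x ⬝ᵥ ((∑ l, G l ⊙ A l) *ᵥ x) := (Matrix.posSemidef_iff_dotProduct_mulVec.mp hS).2 x
      have h2 : 0 < star x ⬝ᵥ (Matrix.diagonal Δ *ᵥ x) := by
        rw [star_trivial]
        simp only [dotProduct, Matrix.mulVec_diagonal]
        obtain ⟨i₀, hi₀⟩ := Function.ne_iff.mp hx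
        apply Finset.sum_pos'
        · intro i _
          have := hΔpos i
          nlinarith [sq_nonneg (x i)]
        · refine ⟨i₀, Finset.mem_univ _, ?_⟩
          have := hΔpos i₀
          have hx0 : 0 < x i₀ ^ 2 := sq_pos_iff.mpr hi₀
          nlinarith
      linarith
  have hrankM : M.rank = Fintype.card I := Matrix.rank_of_isUnit _ hMpd.isUnit
  have hMeq : M = G₀ + ∑ l, ∑ j, G l ⊙ Matrix.vecMulVec (w l j) (w l j) := by
    rw [hM, hdecomp, add_assoc, add_comm (Matrix.diagonal Δ), ← add_assoc, ← Finset.sum_add_distrib]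
    congr 1
    refine Finset.sum_congr rfl fun l _ => ?_
    rw [← hadamard_finset_sum, ← Matrix.hadamard_add, hsplit l]
  have hGr : ∀ l, (G l).rank ≤ (P l).rank := fun l => rank_gram_le (P l) u
  have h1 : M.rank ≤ G₀.rank + (∑ l, ∑ j, G l ⊙ Matrix.vecMulVec (w l j) (w l j)).rank := by
    rw [hMeq]; exact Literature.Computability.AlgebraicComplexity.rank_add_le _ _
  have h2 : (∑ l, ∑ j, G l ⊙ Matrix.vecMulVec (w l j) (w l j)).rank ≤ ∑ l, r l * (P l).rank := by
    refine (Literature.Computability.AlgebraicComplexity.rank_sum_le _ _).trans (Finset.sum_le_sum fun l _ => ?_)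
    refine (Literature.Computability.AlgebraicComplexity.rank_sum_le _ _).trans ?_
    calc ∑ j, (G l ⊙ Matrix.vecMulVec (w l j) (w l j)).rank ≤ ∑ _j : Fin (r l), (P l).rank :=
          Finset.sum_le_sum fun j _ => (rank_hadamard_vecMulVec_le _ _).trans (hGr l)
      _ = r l * (P l).rank := by simp
  have h0 : G₀.rank ≤ P₀.rank := rank_gram_le P₀ u
  calc Fintype.card I = M.rank := hrankM.symm
    _ ≤ P₀.rank + ∑ l, r l * (P l).rank := h1.trans (Nat.add_le_add h0 h2)

/-- **commensurable supports, FAMILY form**: entering-type kernel pairs of `P₀ + τ^e J + Σₗ τ^{e(qₗ+1)} Pₗ` (scales may repeat,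
same-scale pairs polarised) number at most `rank P₀ + Σₗ qₗ·rank Pₗ` — the exchange certificate is defined by ONE formula at all pairs,
so no extra work is needed at equal scales. [folklore] -/
theorem card_negType_family_le_rank_commensurable (q : Fin L → ℕ) (hP₀ : P₀.PosSemidef) (hJ : J.IsSymm)
    (hP : ∀ l, (P l).PosSemidef) (hτ : ∀ i, 0 < τ i) (he : 0 < e) (hq : ∀ l, 1 ≤ q l) (hd : ∀ l, d l = e * (q l + 1))
    (hker : ∀ i, (P₀ + τ i ^ e • J + ∑ l, τ i ^ d l • P l) *ᵥ u i = 0)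
    (htype : ∀ i, ∑ l, ((d l - e : ℕ) : ℝ) * τ i ^ d l * (u i ⬝ᵥ (P l *ᵥ u i)) < e * (u i ⬝ᵥ (P₀ *ᵥ u i)))
    (hsame : ∀ i k, i ≠ k → τ i = τ k →
      (e : ℝ) * (u i ⬝ᵥ (P₀ *ᵥ u k)) = ∑ l, ((d l - e : ℕ) : ℝ) * τ k ^ d l * (u i ⬝ᵥ (P l *ᵥ u k))) :
    Fintype.card I ≤ P₀.rank + ∑ l, q l * (P l).rank := by
  classical
  set s : I → ℝ := fun i => τ i ^ e with hs
  set y : (l : Fin L) → Fin (q l) → I → ℝ := fun l c i => s i ^ ((c : ℕ) + 1) with hy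
  set N : Fin L → Matrix I I ℝ := fun l => Matrix.of fun i k => ∑ c : Fin (q l), y l c i * y l (Fin.rev c) k with hN
  have hNent : ∀ l i k, N l i k = s i * s k * ∑ c ∈ Finset.range (q l), s i ^ c * s k ^ (q l - 1 - c) := by
    intro l i k
    simp only [hN, Matrix.of_apply, hy, Fin.val_rev]
    rw [Fin.sum_univ_eq_sum_range (fun c => s i ^ (c + 1) * s k ^ (q l - (c + 1) + 1)) (q l), Finset.mul_sum]
    refine Finset.sum_congr rfl fun c hc => ?_
    have hc' : c < q l := Finset.mem_range.mp hc
    have e1 : q l - (c + 1) + 1 = q l - 1 - c + 1 := by omega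
    rw [e1, pow_succ, pow_succ]
    ring
  have htd : ∀ l i, τ i ^ d l = s i ^ (q l + 1) := by
    intro l i; rw [hd l, pow_mul]
  have hcast : ∀ l, ((d l - e : ℕ) : ℝ) = (e : ℝ) * (q l : ℝ) := by
    intro l
    rw [hd l, show e * (q l + 1) - e = e * q l by rw [Nat.mul_succ, Nat.add_sub_cancel]]
    push_cast; ring
  refine card_negType_le_rank_split_family P₀ J P e d τ u hP₀ hJ hP hτ he hker htype hsame N ?_ ?_ q y
    (fun l => ∑ c : Fin (q l), ((1 / 2 : ℝ) • Matrix.vecMulVec (y l c + y l (Fin.rev c)) (y l c + y l (Fin.rev c))))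
    (fun l => posSemidef_exchange_split (q l) (y l)) (fun l => exchange_split (q l) (y l))
  · intro l i k hik
    have hsik : s i = s k := by simp only [hs, hik]
    rw [hNent, hsik, geom_sum₂_self, htd, hcast]
    have hq1 : 1 ≤ q l := hq l
    have epow : s k * s k * ((q l : ℝ) * s k ^ (q l - 1)) = (q l : ℝ) * s k ^ (q l + 1) := by
      obtain ⟨r, hr⟩ := Nat.exists_eq_add_of_le hq1
      rw [hr, Nat.add_sub_cancel_left, pow_add, pow_add, pow_one]; ring
    rw [epow]; ring
  · intro l i k _
    rw [hNent, htd, htd]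
    show s i * s k * (∑ c ∈ Finset.range (q l), s i ^ c * s k ^ (q l - 1 - c)) * (s i - s k)
      = s i ^ (q l + 1) * s k - s i * s k ^ (q l + 1)
    rw [mul_assoc, geom_sum₂_mul, pow_succ, pow_succ]
    ring

/-- **clustered supports, FAMILY form**: entering-type kernel pairs of `P₀ + τ^e J + Σₗ τ^{dₗ} Pₗ` with `e < dₗ ≤ 2e` (scales may repeat,
same-scale pairs polarised) number at most `rank P₀` — part F for families, Loewner certificates at repeated nodes. [folklore] -/
theorem card_negType_family_le_rank_clustered (hP₀ : P₀.PosSemidef) (hJ : J.IsSymm) (hP : ∀ l, (P l).PosSemidef)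
    (hτ : ∀ i, 0 < τ i) (he : 0 < e) (hd : ∀ l, e < d l ∧ d l ≤ 2 * e)
    (hker : ∀ i, (P₀ + τ i ^ e • J + ∑ l, τ i ^ d l • P l) *ᵥ u i = 0)
    (htype : ∀ i, ∑ l, ((d l - e : ℕ) : ℝ) * τ i ^ d l * (u i ⬝ᵥ (P l *ᵥ u i)) < e * (u i ⬝ᵥ (P₀ *ᵥ u i)))
    (hsame : ∀ i k, i ≠ k → τ i = τ k →
      (e : ℝ) * (u i ⬝ᵥ (P₀ *ᵥ u k)) = ∑ l, ((d l - e : ℕ) : ℝ) * τ k ^ d l * (u i ⬝ᵥ (P l *ᵥ u k))) :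
    Fintype.card I ≤ P₀.rank := by
  classical
  have he0 : e ≠ 0 := Nat.pos_iff_ne_zero.mp he
  -- Loewner certificates at the (possibly repeated) nodes `τ^e`
  have hcert : ∀ l, ∃ N : Matrix I I ℝ, N.PosSemidef ∧ (∀ i k, τ i = τ k → (e : ℝ) * N i k = ((d l - e : ℕ) : ℝ) * τ k ^ d l) ∧
      ∀ i k, τ i ≠ τ k → N i k * (τ i ^ e - τ k ^ e) = τ i ^ d l * τ k ^ e - τ i ^ e * τ k ^ d l := by
    intro l
    have hed := (hd l).1
    have hq : (((d l - e : ℕ) : ℝ) / e) ∈ Set.Ioc (0 : ℝ) 1 := by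
      refine ⟨div_pos (Nat.cast_pos.mpr (by omega)) (Nat.cast_pos.mpr he), ?_⟩
      rw [div_le_one (Nat.cast_pos.mpr he)]
      exact_mod_cast (by have := (hd l).2; omega : d l - e ≤ e)
    obtain ⟨Lw, hLw, hLdiag, hLoff⟩ :=
      Loewner.exists_loewner_certificate hq (fun i => τ i ^ e) (fun i => pow_pos (hτ i) e)
    refine ⟨Matrix.of fun i k => τ i ^ e * Lw i k * τ k ^ e, ?_, ?_, ?_⟩
    · have hNeq : (Matrix.of fun i k => τ i ^ e * Lw i k * τ k ^ e)
          = (Matrix.diagonal fun i => τ i ^ e) * Lw * (Matrix.diagonal fun i => τ i ^ e) := by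
        ext i k
        simp only [Matrix.of_apply, Matrix.mul_diagonal, Matrix.diagonal_mul]
      rw [hNeq]
      have h := hLw.conjTranspose_mul_mul_same (Matrix.diagonal fun i => τ i ^ e)
      rwa [Matrix.conjTranspose_eq_transpose_of_trivial, Matrix.diagonal_transpose] at h
    · intro i k hik
      simp only [Matrix.of_apply]
      rw [hLdiag i k (by simp only [hik]), Loewner.pow_rpow_div_natCast_sub_one (hτ k) (d l - e) e he0, hik]
      have h1 : τ k ^ e ≠ 0 := pow_ne_zero _ (ne_of_gt (hτ k))
      have heR : (e : ℝ) ≠ 0 := Nat.cast_ne_zero.mpr he0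
      have hsplit : τ k ^ d l = τ k ^ (d l - e) * τ k ^ e := by rw [← pow_add, Nat.sub_add_cancel hed.le]
      rw [hsplit]
      field_simp
    · intro i k hik
      simp only [Matrix.of_apply]
      have hne : τ i ^ e ≠ τ k ^ e := fun h => hik ((pow_left_inj₀ (hτ i).le (hτ k).le he0).mp h)
      have h0 := hLoff i k hne
      rw [Loewner.pow_rpow_div_natCast (hτ i) (d l - e) e he0, Loewner.pow_rpow_div_natCast (hτ k) (d l - e) e he0] at h0
      have hsi : τ i ^ d l = τ i ^ (d l - e) * τ i ^ e := by rw [← pow_add, Nat.sub_add_cancel hed.le]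
      have hsk : τ k ^ d l = τ k ^ (d l - e) * τ k ^ e := by rw [← pow_add, Nat.sub_add_cancel hed.le]
      calc τ i ^ e * Lw i k * τ k ^ e * (τ i ^ e - τ k ^ e)
          = τ i ^ e * τ k ^ e * (Lw i k * (τ i ^ e - τ k ^ e)) := by ring
        _ = τ i ^ e * τ k ^ e * (τ i ^ (d l - e) - τ k ^ (d l - e)) := by rw [h0]
        _ = τ i ^ d l * τ k ^ e - τ i ^ e * τ k ^ d l := by rw [hsi, hsk]; ring
  choose N hNpsd hNsame hNoff using hcert
  have h := card_negType_le_rank_split_family P₀ J P e d τ u hP₀ hJ hP hτ he hker htype hsame N hNsame hNoff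
    (fun _ => 0) (fun l j => Fin.elim0 j) N hNpsd (fun l => by simp)
  simpa using h

end SplitFamily

end TwoSidedThree

end Summit.ValiantsHypothesis.ValiantsHypothesis.Theorems.KPlusLogSqLaw.TowerGraft
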